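import Literature.NumberTheory.EllipticCurves.HeegnerPointsKolyvaginVisibleDescentOrderProofs
import HarnessLib

/-!
# EXACTNESS from a deep depth-one certificate, VISIBLE split form, any prime `p`:
# `#(Sel/ℤx) = p^{2M₀}`, carried by the `-ε` side, the `ε` side being `ℤx`

Visible twin of `HeegnerPointsKolyvaginSplitDescentExactProofs` (McCallum 1991 Thm. 5.4 / Cor. 5.6
in the case `M₁ = 0` for the split data `KolyvaginDescent.SplitHypothesesM`). Same statement and
proof for the VISIBLE data `KolyvaginDescent.VisibleSplitHypothesesM`
(`HeegnerPointsKolyvaginVisibleDescentProofs`; Čebotarev only for families independent after the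
restriction `rK` to `K(E_{p^M})`, the form instantiable at `p = 2`), on top of the visible order
bound `VisibleSplitHypothesesM.card_sel_le_of_casselsTate`
(`HeegnerPointsKolyvaginVisibleDescentOrderProofs`) and the lower-bound element
`VisibleSplitHypothesesM.pow_zsmul_c_mem_sel_inf_part` + Claim A: a `p`-PRIMITIVE derived class
`c_M(ℓ₀)` (full order `p^M`) puts an element of order `p^{M₀}` into the symplectic `-ε` piece
`Q⁻ ≃ L × L` of `Sel/ℤx`, forcing `#Q⁻ ≥ p^{2M₀}`, whence equality and `Q⁺ = 0`:

* `VisibleSplitHypothesesM.card_sel_eq_of_primitive` — **`#Sel = p^M · p^{2M₀}`** and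
  **`Sel ∩ V^{ε} ⊆ ℤx`**, with the annihilator `hkill` displayed;
* `VisibleSplitHypothesesM.card_sel_eq_of_primitive_of_le` — the same with the annihilator
  DISCHARGED by the visible descent (Claims A and B: `E₀ = 2M₀`, so `3M₀ ≤ M` suffices).

At `p = 2` for a VISIBLE pair `(E, E^{(d_K)})` over `ℚ` (`Sel₂(E^{ε}) ⊕ Sel₂(E^{-ε}) ⊕ 𝔽₂ξ_E`
direct in `H¹(ℚ, E[2])`) with a DEEP `2`-primitive `P_{ℓ₀}`: `#Ш(E^{-ε}/ℚ)_{2^M} = 4^{M₀}` and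
`Ш(E^{ε}/ℚ)_{2^M} = 0` — the exact pair conclusion asked by crux Q3′ of the BSD route
`GenusKolyvaginAtTwo`, GRANTED the displayed inputs `hCTV`, `hCeb` (visible kernel form),
`hcsupp`. No definition, no named fact; nothing here is a claim about BSD.

## References

* W. G. McCallum, *Kolyvagin's work on Shafarevich–Tate groups*, LMS LNS 153 (1991): §1 Theorem,
  Thm. 5.4, Cor. 5.6 (p. 314). [McCallumLMS1991]
* V. A. Kolyvagin, Izv. 1989, §3. [Kolyvagin1989Izv]
* C. T. C. Wall, Topology 2 (1963), Lemma 7. [Wall1963QuadraticFormsFiniteGroups]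
-/

open scoped Classical

namespace Literature.NumberTheory.EllipticCurves

namespace KolyvaginDescent

namespace VisibleSplitHypothesesM

open Literature.GroupTheory.FiniteAbelian

section Exact

variable {V : Type*} [AddCommGroup V] {Pl : Type*} {H : Type*} [AddCommGroup H]
variable (S : VisibleSplitHypothesesM V Pl H)

/-! ### Plumbing (restated for this file) -/

/-- `x` has order exactly `p^M`. [folklore] -/
private theorem zsmul_x_eq_zero_iff'' (k : ℤ) : k • S.x = 0 ↔ ((S.p : ℤ) ^ S.M) ∣ k :=
  zsmul_eq_zero_iff_prime_pow_dvd S.hp (S.torsion S.x) S.x_ord k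

/-- `p^{expo s} • s = 0`. [folklore] -/
private theorem pow_expo_zsmul'' (s : V) : ((S.p : ℤ) ^ S.expo s) • s = 0 := by
  have h : ∃ a : ℕ, ((S.p : ℤ) ^ a) • s = 0 := ⟨S.M, S.torsion s⟩
  exact Nat.find_spec h

/-- `p^{expo s - 1} • s ≠ 0` when `expo s ≠ 0`. [folklore] -/
private theorem pow_expo_sub_one_zsmul_ne_zero'' {s : V} (h : S.expo s ≠ 0) :
    ((S.p : ℤ) ^ (S.expo s - 1)) • s ≠ 0 := by
  have h' : ∃ a : ℕ, ((S.p : ℤ) ^ a) • s = 0 := ⟨S.M, S.torsion s⟩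
  have hlt : S.expo s - 1 < Nat.find h' := Nat.sub_one_lt h
  exact Nat.find_min h' hlt

/-- `expo s ≤ a` as soon as `p^a • s = 0`. [folklore] -/
private theorem expo_le_of_pow_zsmul_eq_zero'' {s : V} {a : ℕ} (h : ((S.p : ℤ) ^ a) • s = 0) :
    S.expo s ≤ a := by
  have h' : ∃ a : ℕ, ((S.p : ℤ) ^ a) • s = 0 := ⟨S.M, S.torsion s⟩
  exact Nat.find_min' h' h

/-- `ord s = p^{expo s}`. [folklore] -/
private theorem addOrderOf_eq_pow_expo'' (s : V) : addOrderOf s = S.p ^ S.expo s := by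
  by_cases h : S.expo s = 0
  · have hs : s = 0 := by
      have := S.pow_expo_zsmul'' s
      rwa [h, pow_zero, one_smul] at this
    rw [h, pow_zero, hs, addOrderOf_zero]
  · exact addOrderOf_eq_prime_pow S.hp (S.pow_expo_zsmul'' s) (S.pow_expo_sub_one_zsmul_ne_zero'' h)

/-- `V^{ε} ∩ V^{-ε} = 0`. [folklore] -/
private theorem eq_zero_of_mem_part_both' {v : V} (h₁ : v ∈ S.part S.ε) (h₂ : v ∈ S.part (-S.ε)) :
    v = 0 := by
  rcases S.hε with h | h
  · rw [h] at h₁ h₂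
    exact S.part_disjoint v h₁ h₂
  · rw [h] at h₁ h₂
    rw [neg_neg] at h₂
    exact S.part_disjoint v h₂ h₁

/-- A class in `V^{-ε}` is pure. [folklore] -/
private theorem pure_of_mem_part_neg' {s : V} (hs : s ∈ S.part (-S.ε)) (a : ℤ)
    (h : a • s ∈ AddSubgroup.zmultiples S.x) : a • s = 0 := by
  obtain ⟨k, hk⟩ := AddSubgroup.mem_zmultiples_iff.mp h
  have h1 : a • s ∈ S.part S.ε := by rw [← hk]; exact (S.part S.ε).zsmul_mem S.x_part _
  exact S.eq_zero_of_mem_part_both' h1 ((S.part (-S.ε)).zsmul_mem hs _)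

/-- `z ↦ 0` in `Sel/ℤx` iff `z ∈ ℤx`. [folklore] -/
private theorem quotient_mk_eq_zero_iff'' (z : S.Sel) :
    (QuotientAddGroup.mk z : S.Sel ⧸ (AddSubgroup.zmultiples S.x).addSubgroupOf S.Sel) = 0 ↔
      (z : V) ∈ AddSubgroup.zmultiples S.x := by
  rw [QuotientAddGroup.eq_zero_iff, AddSubgroup.mem_addSubgroupOf]

/-- Membership in `ℤx ∩ Sel`. [folklore] -/
private theorem mem_zmultiples_addSubgroupOf_iff'' (z : S.Sel) :
    z ∈ (AddSubgroup.zmultiples S.x).addSubgroupOf S.Sel ↔ ∃ k : ℤ, z = k • ⟨S.x, S.x_mem⟩ := by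
  rw [AddSubgroup.mem_addSubgroupOf, AddSubgroup.mem_zmultiples_iff]
  constructor
  · rintro ⟨k, hk⟩
    exact ⟨k, Subtype.ext (by simpa using hk.symm)⟩
  · rintro ⟨k, rfl⟩
    exact ⟨k, by simp⟩

/-- A bi-additive pairing on `Sel` vanishing against `x` on both sides descends to `Sel/ℤx`.
[folklore] -/
private theorem exists_quotient_pairing'' {R : Type*} [AddCommGroup R] (P : S.Sel →+ S.Sel →+ R)
    (hPx₁ : ∀ t, P ⟨S.x, S.x_mem⟩ t = 0) (hPx₂ : ∀ z, P z ⟨S.x, S.x_mem⟩ = 0) :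
    ∃ B : (S.Sel ⧸ (AddSubgroup.zmultiples S.x).addSubgroupOf S.Sel) →+
        (S.Sel ⧸ (AddSubgroup.zmultiples S.x).addSubgroupOf S.Sel) →+ R,
      ∀ z t : S.Sel, B (QuotientAddGroup.mk z) (QuotientAddGroup.mk t) = P z t := by
  set N := (AddSubgroup.zmultiples S.x).addSubgroupOf S.Sel with hN
  have hker : ∀ z : S.Sel, N ≤ (P z).ker := by
    intro z t ht
    rw [hN, S.mem_zmultiples_addSubgroupOf_iff''] at ht
    obtain ⟨k, rfl⟩ := ht
    rw [AddMonoidHom.mem_ker, map_zsmul, hPx₂, smul_zero]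
  let φ : S.Sel →+ ((S.Sel ⧸ N) →+ R) :=
    AddMonoidHom.mk' (fun z ↦ QuotientAddGroup.lift N (P z) (hker z)) fun z z' ↦ by
      apply QuotientAddGroup.addMonoidHom_ext
      ext t
      simp only [AddMonoidHom.coe_comp, Function.comp_apply, QuotientAddGroup.mk'_apply,
        QuotientAddGroup.lift_mk, map_add, AddMonoidHom.add_apply]
  have hφ : ∀ z t : S.Sel, φ z (QuotientAddGroup.mk t) = P z t := fun z t ↦ by
    simp only [φ, AddMonoidHom.mk'_apply, QuotientAddGroup.lift_mk]
  have hkerφ : N ≤ φ.ker := by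
    intro z hz
    rw [hN, S.mem_zmultiples_addSubgroupOf_iff''] at hz
    obtain ⟨k, rfl⟩ := hz
    rw [AddMonoidHom.mem_ker]
    apply QuotientAddGroup.addMonoidHom_ext
    ext t
    simp only [AddMonoidHom.coe_comp, Function.comp_apply, QuotientAddGroup.mk'_apply, hφ,
      map_zsmul, AddMonoidHom.zsmul_apply, hPx₁, smul_zero, AddMonoidHom.zero_apply]
  refine ⟨QuotientAddGroup.lift N φ hkerφ, fun z t ↦ ?_⟩
  rw [QuotientAddGroup.lift_mk, hφ]

/-- `#Sel = p^M · #(Sel/ℤx)`. [folklore] -/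
private theorem card_sel_eq'' :
    Nat.card S.Sel =
      S.p ^ S.M * Nat.card (S.Sel ⧸ (AddSubgroup.zmultiples S.x).addSubgroupOf S.Sel) := by
  have hle : AddSubgroup.zmultiples S.x ≤ S.Sel := AddSubgroup.zmultiples_le.mpr S.x_mem
  rw [AddSubgroup.card_eq_card_quotient_mul_card_addSubgroup
    ((AddSubgroup.zmultiples S.x).addSubgroupOf S.Sel), mul_comm,
    Nat.card_congr (AddSubgroup.addSubgroupOfEquivOfLe hle).toEquiv, Nat.card_zmultiples,
    addOrderOf_eq_prime_pow S.hp (S.torsion S.x) S.x_ord]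

/-- The lower-bound element with Claim A: `t = p^{M−M₀} c_M(ℓ) ∈ Sel ∩ V^{-ε}`, `p^{M₀} t = 0`,
`p^{M₀−m−1} t ≠ 0` when `p^{M−m−1} c_M(ℓ) ≠ 0` (`m < M₀ ≤ M`).
[cite: McCallumLMS1991, §5 Thm. 5.4 (proof, case i = 1)] -/
private theorem exists_mem_sel_part_neg_of_pow_zsmul_c_ne_zero' (hM₀ : S.M₀ ≤ S.M) {m : ℕ}
    (hm : m < S.M₀) {ℓ : ℕ} (hℓ : S.Kol ℓ) (hc : ((S.p : ℤ) ^ (S.M - m - 1)) • S.c ℓ ≠ 0) :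
    ∃ t ∈ S.Sel, t ∈ S.part (-S.ε) ∧ ((S.p : ℤ) ^ (S.M₀ - m - 1)) • t ≠ 0 ∧
      ((S.p : ℤ) ^ S.M₀) • t = 0 := by
  have hmem := AddSubgroup.mem_inf.mp (S.pow_zsmul_c_mem_sel_inf_part hM₀ hℓ)
  refine ⟨_, hmem.1, hmem.2, ?_, S.claimA hmem.1 hmem.2⟩
  rw [smul_smul, ← pow_add, show S.M₀ - m - 1 + (S.M - S.M₀) = S.M - m - 1 by omega]
  exact hc

/-! ### Exactness -/

/-- **McCallum's Thm. 5.4 / Cor. 5.6 in the case `M₁ = 0`, VISIBLE split form, ANY prime `p`: from a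
`p`-PRIMITIVE derived class `c_M(ℓ₀)` (full order `p^M`: `P_{ℓ₀} ∉ pE(K_{ℓ₀})`, `ℓ₀` a Kolyvagin
prime of the data, i.e. of level `≥ M`) the bound `#(Sel/ℤx) ≤ p^{2M₀}` is an EQUALITY, carried by
the `-ε` side: `#Sel = p^M · p^{2M₀}` and every class of `Sel ∩ V^{ε}` is a multiple of `x`.**
Hypotheses: those of `card_sel_le_of_casselsTate` (Cassels–Tate pairing `P` on `Sel`, alternating,
cross-isotropic, vanishing against `x`, non-degenerate mod `ℤx`; `hCTV`; `hCeb` in visible kernel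
form; `hcsupp`; annihilator `p^{E₀} Sel ⊆ ℤx` with `E₀ + M₀ ≤ M`), `M₀ ≤ M`, and
`p^{M−1} c(ℓ₀) ≠ 0`. Proof:
`c_{M₀}(ℓ₀) = p^{M−M₀} c(ℓ₀) ∈ Sel ∩ V^{-ε}` has order `p^{M₀}` and is pure, so its image in the
`-ε` piece `Q⁻` of `Q = Sel/ℤx` has order `p^{M₀}`; `Q⁻` is a symplectic module `≃ L × L`, hence
`p^{M₀} ∣ #L` and `#Q⁻ ≥ p^{2M₀}`; with `#Q = #Q⁺ · #Q⁻ ≤ p^{2M₀}`: `#Q⁻ = p^{2M₀}`, `Q⁺ = 0`.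
[cite: McCallumLMS1991, Thm. 5.4, Cor. 5.6 (case M₁ = 0)] [cite: Kolyvagin1989Izv, §3]
[cite: Wall1963QuadraticFormsFiniteGroups, Lemma 7] -/
theorem card_sel_eq_of_primitive [Finite S.Sel] (P : S.Sel →+ S.Sel →+ AddCircle (1 : ℚ))
    (halt : ∀ z, P z z = 0)
    (hPcross : ∀ z t : S.Sel, (z : V) ∈ S.part S.ε → (t : V) ∈ S.part (-S.ε) → P z t = 0)
    (hPx : ∀ t, P ⟨S.x, S.x_mem⟩ t = 0)
    (hnd : ∀ z : S.Sel, (∀ t, P z t = 0) → (z : V) ∈ AddSubgroup.zmultiples S.x)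
    (hCTV : ∀ ℓ m : ℕ, S.Kol ℓ → KolSupp S.Kol (ℓ * m) → ¬ ℓ ∣ m →
      ∀ (j N a b : ℕ) (t : V) (ht : t ∈ S.Sel) (hz : ((S.p : ℤ) ^ j) • S.c (ℓ * m) ∈ S.Sel),
      ((S.p : ℤ) ^ N) • t = 0 → t ∈ S.part (S.ε * (-1) ^ (ℓ * m).primeFactors.card) →
      (∀ q ∈ m.primeFactors, t ∈ S.A q) → S.M - S.M₀ ≤ j → N + S.M₀ ≤ S.M → N ≤ j → a + b + 1 = N →
      ((S.p : ℤ) ^ (a + (j - N))) • S.c m ∉ S.A ℓ → ((S.p : ℤ) ^ b) • t ∉ S.A ℓ →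
      P ⟨_, hz⟩ ⟨t, ht⟩ ≠ 0)
    (hCeb : ∀ (T : Finset V) (g₁ g₂ : V) (ν : ℤ), (ν = 1 ∨ ν = -1) → g₁ ∈ S.part ν →
      g₂ ∈ S.part (-ν) → (∀ t ∈ T, ∃ e : ℤ, (e = 1 ∨ e = -1) ∧ t ∈ S.part e) →
      (∀ g ∈ AddSubgroup.closure (insert g₁ (insert g₂ (T : Set V))), S.rK g = 0 → g = 0) →
      ∀ b : ℕ, ∃ ℓ, b < ℓ ∧ S.Kol ℓ ∧ (∀ t ∈ T, t ∈ S.A ℓ) ∧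
        (∀ j : ℕ, ((S.p : ℤ) ^ j) • g₁ ∈ S.A ℓ ↔
          ((S.p : ℤ) ^ j) • g₁ ∈ AddSubgroup.closure (T : Set V)) ∧
        (∀ j : ℕ, ((S.p : ℤ) ^ j) • g₂ ∈ S.A ℓ ↔
          ((S.p : ℤ) ^ j) • g₂ ∈ AddSubgroup.closure (T : Set V)))
    (hcsupp : ∀ n, KolSupp S.Kol n → ∀ v, (∀ q, S.Kol q → v ≠ S.pl q) → S.c n ∈ S.Loc v)
    {E₀ : ℕ} (hkill : ∀ t ∈ S.Sel, ((S.p : ℤ) ^ E₀) • t ∈ AddSubgroup.zmultiples S.x)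
    (hE : E₀ + S.M₀ ≤ S.M) (hM₀ : S.M₀ ≤ S.M)
    {ℓ₀ : ℕ} (hℓ₀ : S.Kol ℓ₀) (hc₀ : ((S.p : ℤ) ^ (S.M - 1)) • S.c ℓ₀ ≠ 0) :
    Nat.card S.Sel = S.p ^ S.M * S.p ^ (2 * S.M₀) ∧
      ∀ s ∈ S.Sel, s ∈ S.part S.ε → s ∈ AddSubgroup.zmultiples S.x := by
  classical
  have hp := S.hp
  -- ### the upper bound
  have hle := S.card_sel_le_of_casselsTate P halt hPcross hPx hnd hCTV hCeb hcsupp hkill hE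
  -- ### skew-symmetry; the quotient and its pairing
  have hskew : ∀ z t, P z t = -P t z := fun z t ↦ by
    have h := halt (z + t)
    simp only [map_add, AddMonoidHom.add_apply, halt, zero_add, add_zero] at h
    exact eq_neg_of_add_eq_zero_right h
  have hPx' : ∀ z, P z ⟨S.x, S.x_mem⟩ = 0 := fun z ↦ by rw [hskew, hPx, neg_zero]
  have hPcross' : ∀ z t : S.Sel, (z : V) ∈ S.part (-S.ε) → (t : V) ∈ S.part S.ε → P z t = 0 :=
    fun z t hz ht ↦ by rw [hskew, hPcross t z ht hz, neg_zero]
  set N := (AddSubgroup.zmultiples S.x).addSubgroupOf S.Sel with hN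
  obtain ⟨B, hB⟩ := S.exists_quotient_pairing'' P hPx hPx'
  have haltB : ∀ q, B q q = 0 := fun q ↦ by
    induction q using QuotientAddGroup.induction_on with
    | H z => rw [hB, halt]
  have hndB : ∀ q, (∀ r, B q r = 0) → q = 0 := by
    intro q hq
    induction q using QuotientAddGroup.induction_on with
    | H z =>
      rw [S.quotient_mk_eq_zero_iff'']
      exact hnd z fun t ↦ by rw [← hB]; exact hq _
  set Selp : AddSubgroup S.Sel := (S.part S.ε).addSubgroupOf S.Sel with hSelp
  set Selm : AddSubgroup S.Sel := (S.part (-S.ε)).addSubgroupOf S.Sel with hSelm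
  set Qp : AddSubgroup (S.Sel ⧸ N) := Selp.map (QuotientAddGroup.mk' N) with hQp
  set Qm : AddSubgroup (S.Sel ⧸ N) := Selm.map (QuotientAddGroup.mk' N) with hQm
  have hmemQp : ∀ {q}, q ∈ Qp ↔ ∃ z : S.Sel, (z : V) ∈ S.part S.ε ∧ QuotientAddGroup.mk z = q := by
    intro q
    simp only [hQp, hSelp, AddSubgroup.mem_map, AddSubgroup.mem_addSubgroupOf,
      QuotientAddGroup.mk'_apply]
  have hmemQm : ∀ {q}, q ∈ Qm ↔
      ∃ z : S.Sel, (z : V) ∈ S.part (-S.ε) ∧ QuotientAddGroup.mk z = q := by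
    intro q
    simp only [hQm, hSelm, AddSubgroup.mem_map, AddSubgroup.mem_addSubgroupOf,
      QuotientAddGroup.mk'_apply]
  have hsup : ∀ q : S.Sel ⧸ N, ∃ a ∈ Qp, ∃ b ∈ Qm, a + b = q := by
    intro q
    induction q using QuotientAddGroup.induction_on with
    | H z =>
      obtain ⟨s₁, s₂, ⟨h₁, h₁'⟩, ⟨h₂, h₂'⟩, hsum⟩ := S.sel_split z z.2
      rcases S.hε with hε | hε
      · refine ⟨QuotientAddGroup.mk ⟨s₁, h₁⟩, hmemQp.mpr ⟨⟨s₁, h₁⟩, by rw [hε]; exact h₁', rfl⟩,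
          QuotientAddGroup.mk ⟨s₂, h₂⟩, hmemQm.mpr ⟨⟨s₂, h₂⟩, by rw [hε]; exact h₂', rfl⟩, ?_⟩
        rw [← QuotientAddGroup.mk_add]
        exact congrArg _ (Subtype.ext hsum.symm)
      · refine ⟨QuotientAddGroup.mk ⟨s₂, h₂⟩, hmemQp.mpr ⟨⟨s₂, h₂⟩, by rw [hε]; exact h₂', rfl⟩,
          QuotientAddGroup.mk ⟨s₁, h₁⟩,
          hmemQm.mpr ⟨⟨s₁, h₁⟩, by rw [hε, neg_neg]; exact h₁', rfl⟩, ?_⟩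
        rw [← QuotientAddGroup.mk_add]
        exact congrArg _ (Subtype.ext (by rw [hsum, add_comm]; rfl))
  have hcodisj : Codisjoint Qp Qm := by
    rw [codisjoint_iff, eq_top_iff]
    intro q _
    obtain ⟨a, ha, b, hb, rfl⟩ := hsup q
    exact AddSubgroup.add_mem_sup ha hb
  have hdisj : Disjoint Qp Qm := by
    rw [AddSubgroup.disjoint_def]
    intro q hq₁ hq₂
    obtain ⟨z, hz, rfl⟩ := hmemQp.mp hq₁
    obtain ⟨t, ht, hzt⟩ := hmemQm.mp hq₂
    have hdiff : ((t : V) - z) ∈ AddSubgroup.zmultiples S.x := by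
      have h0 : (QuotientAddGroup.mk (t - z) : S.Sel ⧸ N) = 0 := by
        rw [QuotientAddGroup.mk_sub, hzt, sub_self]
      rw [S.quotient_mk_eq_zero_iff''] at h0
      simpa using h0
    have htε : (t : V) ∈ S.part S.ε := by
      obtain ⟨k, hk⟩ := AddSubgroup.mem_zmultiples_iff.mp hdiff
      have : (t : V) = k • S.x + z := by rw [hk]; abel
      rw [this]
      exact (S.part S.ε).add_mem ((S.part S.ε).zsmul_mem S.x_part _) hz
    have ht0 : t = 0 := Subtype.ext (S.eq_zero_of_mem_part_both' htε ht)
    rw [← hzt, ht0, QuotientAddGroup.mk_zero]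
  have hcompl : IsCompl Qp Qm := ⟨hdisj, hcodisj⟩
  have hBcross' : ∀ a ∈ Qm, ∀ b ∈ Qp, B a b = 0 := by
    intro a ha b hb
    obtain ⟨z, hz, rfl⟩ := hmemQm.mp ha
    obtain ⟨t, ht, rfl⟩ := hmemQp.mp hb
    rw [hB]
    exact hPcross' z t hz ht
  have hndm : ∀ q ∈ Qm, (∀ r ∈ Qm, B q r = 0) → q = 0 := by
    intro q hq h
    refine hndB q fun r ↦ ?_
    obtain ⟨a, ha, b, hb, rfl⟩ := hsup r
    rw [map_add, hBcross' q hq a ha, h b hb, zero_add]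
  -- ### the symplectic structure of `Q⁻`: `Q⁻ ≃ L × L`
  set B₀ : Qm →+ Qm →+ AddCircle (1 : ℚ) := (B.comp Qm.subtype).compl₂ Qm.subtype with hB₀
  have hB₀ap : ∀ a b : Qm, B₀ a b = B a b := fun a b ↦ rfl
  have halt₀ : ∀ a : Qm, B₀ a a = 0 := fun a ↦ by rw [hB₀ap, haltB]
  have hnd₀ : ∀ a : Qm, (∀ b, B₀ a b = 0) → a = 0 := fun a ha ↦
    Subtype.ext (hndm a a.2 fun r hr ↦ by rw [← hB₀ap a ⟨r, hr⟩]; exact ha _)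
  obtain ⟨L, -, ⟨e⟩⟩ := exists_addEquiv_prod_self B₀ halt₀ hnd₀
  -- ### the element of order `p^{M₀}` in `Q⁻`
  have hcard_ge : S.p ^ (2 * S.M₀) ≤ Nat.card Qm := by
    rcases Nat.eq_zero_or_pos S.M₀ with hM0 | hM0
    · rw [hM0, mul_zero, pow_zero]
      exact Nat.card_pos
    obtain ⟨t, htS, hte, ht1, ht0⟩ := S.exists_mem_sel_part_neg_of_pow_zsmul_c_ne_zero' hM₀ hM0 hℓ₀
      (by rw [Nat.sub_zero]; exact hc₀)
    rw [Nat.sub_zero] at ht1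
    -- `expo t = M₀`
    have hexpo : S.expo t = S.M₀ := by
      refine le_antisymm (S.expo_le_of_pow_zsmul_eq_zero'' ht0) ?_
      by_contra hlt
      push Not at hlt
      exact ht1 (pow_zsmul_eq_zero_of_le (by omega) (S.pow_expo_zsmul'' t))
    -- its image `q ∈ Q⁻` has order `p^{M₀}` (`t` is pure)
    set q : S.Sel ⧸ N := QuotientAddGroup.mk ⟨t, htS⟩ with hq
    have hqm : q ∈ Qm := hmemQm.mpr ⟨⟨t, htS⟩, hte, rfl⟩
    have hordq : addOrderOf q = S.p ^ S.M₀ := by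
      rw [← hexpo, hq, ← S.addOrderOf_eq_pow_expo'' t, addOrderOf_eq_addOrderOf_iff]
      intro n
      rw [← QuotientAddGroup.mk_nsmul, S.quotient_mk_eq_zero_iff'', AddSubgroupClass.coe_nsmul,
        ← natCast_zsmul]
      exact ⟨fun h ↦ S.pure_of_mem_part_neg' hte _ h, fun h ↦ by rw [h]; exact zero_mem _⟩
    -- transport to `L × L`: `p^{M₀} ∣ #L`
    have hordq' : addOrderOf (e ⟨q, hqm⟩) = S.p ^ S.M₀ := by
      rw [AddEquiv.addOrderOf_eq, ← hordq]
      exact (addOrderOf_injective Qm.subtype Subtype.val_injective ⟨q, hqm⟩).symm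
    have hdvd : S.p ^ S.M₀ ∣ Nat.card L := by
      rw [← hordq', Prod.addOrderOf]
      exact Nat.lcm_dvd (addOrderOf_dvd_natCard _) (addOrderOf_dvd_natCard _)
    have hLpos : 0 < Nat.card L := Nat.card_pos
    have hL : S.p ^ S.M₀ ≤ Nat.card L := Nat.le_of_dvd hLpos hdvd
    rw [Nat.card_congr e.toEquiv, Nat.card_prod, two_mul, pow_add]
    exact Nat.mul_le_mul hL hL
  -- ### counting
  have hQ : Nat.card (S.Sel ⧸ N) = Nat.card Qp * Nat.card Qm := card_eq_mul_of_isCompl hcompl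
  have hSel : Nat.card S.Sel = S.p ^ S.M * (Nat.card Qp * Nat.card Qm) := by
    rw [← hQ]; exact S.card_sel_eq''
  have hppos : 0 < S.p ^ S.M := pow_pos hp.pos _
  have hQp_pos : 0 < Nat.card Qp := Nat.card_pos
  have hQle : Nat.card Qp * Nat.card Qm ≤ S.p ^ (2 * S.M₀) := by
    rw [hSel] at hle
    exact Nat.le_of_mul_le_mul_left hle hppos
  have hipos : 0 < S.p ^ (2 * S.M₀) := pow_pos hp.pos _
  have hQp1 : Nat.card Qp = 1 := by
    by_contra h
    have h2 : 2 ≤ Nat.card Qp := by omega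
    have : 2 * S.p ^ (2 * S.M₀) ≤ Nat.card Qp * Nat.card Qm := Nat.mul_le_mul h2 hcard_ge
    omega
  have hQm_eq : Nat.card Qm = S.p ^ (2 * S.M₀) := by
    refine le_antisymm ?_ hcard_ge
    rw [hQp1, one_mul] at hQle
    exact hQle
  refine ⟨by rw [hSel, hQp1, one_mul, hQm_eq], fun s hs hse ↦ ?_⟩
  -- `Q⁺ = 0`: every class of `Sel ∩ V^{ε}` is `≡ 0 mod ℤx`
  have hQp_bot : Qp = ⊥ := Qp.eq_bot_of_card_eq hQp1
  have hmem : (QuotientAddGroup.mk ⟨s, hs⟩ : S.Sel ⧸ N) ∈ Qp := hmemQp.mpr ⟨⟨s, hs⟩, hse, rfl⟩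
  rw [hQp_bot, AddSubgroup.mem_bot, S.quotient_mk_eq_zero_iff''] at hmem
  exact hmem

/-- **Exactness with the annihilator discharged** (`E₀ = 2M₀` by Claims A and B of the visible
descent): for VISIBLE split data with `3M₀ ≤ M`, a Cassels–Tate pairing as in
`card_sel_eq_of_primitive`, `hCTV`, `hCeb` (visible kernel form), `hcsupp` and a `p`-primitive
`c_M(ℓ₀)`: **`#Sel = p^M · p^{2M₀}` and `Sel ∩ V^{ε} ⊆ ℤx`.** At `2` for a visible pair with a deep
`2`-primitive derived point: `#Ш(E^{-ε}/ℚ)_{2^M} = 4^{M₀}`, `Ш(E^{ε}/ℚ)_{2^M} = 0`.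
[cite: McCallumLMS1991, Thm. 5.4, Cor. 5.6 (case M₁ = 0)] [cite: Kolyvagin1989Izv, §3] -/
theorem card_sel_eq_of_primitive_of_le [Finite S.Sel] (P : S.Sel →+ S.Sel →+ AddCircle (1 : ℚ))
    (halt : ∀ z, P z z = 0)
    (hPcross : ∀ z t : S.Sel, (z : V) ∈ S.part S.ε → (t : V) ∈ S.part (-S.ε) → P z t = 0)
    (hPx : ∀ t, P ⟨S.x, S.x_mem⟩ t = 0)
    (hnd : ∀ z : S.Sel, (∀ t, P z t = 0) → (z : V) ∈ AddSubgroup.zmultiples S.x)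
    (hCTV : ∀ ℓ m : ℕ, S.Kol ℓ → KolSupp S.Kol (ℓ * m) → ¬ ℓ ∣ m →
      ∀ (j N a b : ℕ) (t : V) (ht : t ∈ S.Sel) (hz : ((S.p : ℤ) ^ j) • S.c (ℓ * m) ∈ S.Sel),
      ((S.p : ℤ) ^ N) • t = 0 → t ∈ S.part (S.ε * (-1) ^ (ℓ * m).primeFactors.card) →
      (∀ q ∈ m.primeFactors, t ∈ S.A q) → S.M - S.M₀ ≤ j → N + S.M₀ ≤ S.M → N ≤ j → a + b + 1 = N →
      ((S.p : ℤ) ^ (a + (j - N))) • S.c m ∉ S.A ℓ → ((S.p : ℤ) ^ b) • t ∉ S.A ℓ →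
      P ⟨_, hz⟩ ⟨t, ht⟩ ≠ 0)
    (hCeb : ∀ (T : Finset V) (g₁ g₂ : V) (ν : ℤ), (ν = 1 ∨ ν = -1) → g₁ ∈ S.part ν →
      g₂ ∈ S.part (-ν) → (∀ t ∈ T, ∃ e : ℤ, (e = 1 ∨ e = -1) ∧ t ∈ S.part e) →
      (∀ g ∈ AddSubgroup.closure (insert g₁ (insert g₂ (T : Set V))), S.rK g = 0 → g = 0) →
      ∀ b : ℕ, ∃ ℓ, b < ℓ ∧ S.Kol ℓ ∧ (∀ t ∈ T, t ∈ S.A ℓ) ∧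
        (∀ j : ℕ, ((S.p : ℤ) ^ j) • g₁ ∈ S.A ℓ ↔
          ((S.p : ℤ) ^ j) • g₁ ∈ AddSubgroup.closure (T : Set V)) ∧
        (∀ j : ℕ, ((S.p : ℤ) ^ j) • g₂ ∈ S.A ℓ ↔
          ((S.p : ℤ) ^ j) • g₂ ∈ AddSubgroup.closure (T : Set V)))
    (hcsupp : ∀ n, KolSupp S.Kol n → ∀ v, (∀ q, S.Kol q → v ≠ S.pl q) → S.c n ∈ S.Loc v)
    (h3 : 3 * S.M₀ ≤ S.M) {ℓ₀ : ℕ} (hℓ₀ : S.Kol ℓ₀) (hc₀ : ((S.p : ℤ) ^ (S.M - 1)) • S.c ℓ₀ ≠ 0) :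
    Nat.card S.Sel = S.p ^ S.M * S.p ^ (2 * S.M₀) ∧
      ∀ s ∈ S.Sel, s ∈ S.part S.ε → s ∈ AddSubgroup.zmultiples S.x := by
  -- the annihilator `p^{2M₀} Sel ⊆ ℤx` from Claims A and B
  have hkill : ∀ t ∈ S.Sel, ((S.p : ℤ) ^ (2 * S.M₀)) • t ∈ AddSubgroup.zmultiples S.x := by
    intro t ht
    obtain ⟨s₁, s₂, ⟨h₁, h₁'⟩, ⟨h₂, h₂'⟩, hsum⟩ := S.sel_split t ht
    -- the two parts, in the order `(ε, -ε)`
    have key : ∀ sp sm : V, sp ∈ S.Sel → sp ∈ S.part S.ε → sm ∈ S.Sel → sm ∈ S.part (-S.ε) →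
        ((S.p : ℤ) ^ (2 * S.M₀)) • (sp + sm) ∈ AddSubgroup.zmultiples S.x := by
      intro sp sm hsp hspe hsm hsme
      obtain ⟨a, ha⟩ := S.claimB hsp hspe
      have hsm0 : ((S.p : ℤ) ^ (2 * S.M₀)) • sm = 0 :=
        pow_zsmul_eq_zero_of_le (by omega) (S.claimA hsm hsme)
      rw [zsmul_add, ha, hsm0, add_zero]
      exact AddSubgroup.zsmul_mem _ (AddSubgroup.mem_zmultiples _) _
    rcases S.hε with hε | hε
    · rw [hsum]
      exact key s₁ s₂ h₁ (by rw [hε]; exact h₁') h₂ (by rw [hε]; exact h₂')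
    · rw [hsum, add_comm]
      exact key s₂ s₁ h₂ (by rw [hε]; exact h₂') h₁ (by rw [hε, neg_neg]; exact h₁')
  exact S.card_sel_eq_of_primitive P halt hPcross hPx hnd hCTV hCeb hcsupp hkill (by omega) (by omega)
    hℓ₀ hc₀

/-! ### Exactness with the value formula restricted to `p^{2M₀}`-torsion classes

Appended by the BSD route `GenusKolyvaginAtTwo` (seat `bsd-line-gk2-p2` g12): the two exactness theorems
VERBATIM, with `hCTV` assumed only for `t` with `p^{2M₀} t = 0`
(`card_sel_le_of_casselsTate_of_torsion`) — the form in which the Cassels–Tate pairing pulled back to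
`S_{p^M}` actually satisfies it. -/

/-- **Exactness from a deep `p`-primitive certificate, value formula on `p^{2M₀}`-torsion classes only.** As
`card_sel_eq_of_primitive`, with the restricted `hCTV`. [cite: McCallumLMS1991, Thm. 5.4, Cor. 5.6 (case M₁ = 0)]
[cite: Kolyvagin1989Izv, §3] [cite: Wall1963QuadraticFormsFiniteGroups, Lemma 7] -/
theorem card_sel_eq_of_primitive_of_torsion [Finite S.Sel] (P : S.Sel →+ S.Sel →+ AddCircle (1 : ℚ))
    (halt : ∀ z, P z z = 0)
    (hPcross : ∀ z t : S.Sel, (z : V) ∈ S.part S.ε → (t : V) ∈ S.part (-S.ε) → P z t = 0)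
    (hPx : ∀ t, P ⟨S.x, S.x_mem⟩ t = 0)
    (hnd : ∀ z : S.Sel, (∀ t, P z t = 0) → (z : V) ∈ AddSubgroup.zmultiples S.x)
    (hCTV : ∀ ℓ m : ℕ, S.Kol ℓ → KolSupp S.Kol (ℓ * m) → ¬ ℓ ∣ m →
      ∀ (j N a b : ℕ) (t : V) (ht : t ∈ S.Sel) (hz : ((S.p : ℤ) ^ j) • S.c (ℓ * m) ∈ S.Sel),
      ((S.p : ℤ) ^ N) • t = 0 → ((S.p : ℤ) ^ (2 * S.M₀)) • t = 0 →
      t ∈ S.part (S.ε * (-1) ^ (ℓ * m).primeFactors.card) →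
      (∀ q ∈ m.primeFactors, t ∈ S.A q) → S.M - S.M₀ ≤ j → N + S.M₀ ≤ S.M → N ≤ j → a + b + 1 = N →
      ((S.p : ℤ) ^ (a + (j - N))) • S.c m ∉ S.A ℓ → ((S.p : ℤ) ^ b) • t ∉ S.A ℓ →
      P ⟨_, hz⟩ ⟨t, ht⟩ ≠ 0)
    (hCeb : ∀ (T : Finset V) (g₁ g₂ : V) (ν : ℤ), (ν = 1 ∨ ν = -1) → g₁ ∈ S.part ν →
      g₂ ∈ S.part (-ν) → (∀ t ∈ T, ∃ e : ℤ, (e = 1 ∨ e = -1) ∧ t ∈ S.part e) →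
      (∀ g ∈ AddSubgroup.closure (insert g₁ (insert g₂ (T : Set V))), S.rK g = 0 → g = 0) →
      ∀ b : ℕ, ∃ ℓ, b < ℓ ∧ S.Kol ℓ ∧ (∀ t ∈ T, t ∈ S.A ℓ) ∧
        (∀ j : ℕ, ((S.p : ℤ) ^ j) • g₁ ∈ S.A ℓ ↔
          ((S.p : ℤ) ^ j) • g₁ ∈ AddSubgroup.closure (T : Set V)) ∧
        (∀ j : ℕ, ((S.p : ℤ) ^ j) • g₂ ∈ S.A ℓ ↔
          ((S.p : ℤ) ^ j) • g₂ ∈ AddSubgroup.closure (T : Set V)))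
    (hcsupp : ∀ n, KolSupp S.Kol n → ∀ v, (∀ q, S.Kol q → v ≠ S.pl q) → S.c n ∈ S.Loc v)
    {E₀ : ℕ} (hkill : ∀ t ∈ S.Sel, ((S.p : ℤ) ^ E₀) • t ∈ AddSubgroup.zmultiples S.x)
    (hE : E₀ + S.M₀ ≤ S.M) (hM₀ : S.M₀ ≤ S.M)
    {ℓ₀ : ℕ} (hℓ₀ : S.Kol ℓ₀) (hc₀ : ((S.p : ℤ) ^ (S.M - 1)) • S.c ℓ₀ ≠ 0) :
    Nat.card S.Sel = S.p ^ S.M * S.p ^ (2 * S.M₀) ∧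
      ∀ s ∈ S.Sel, s ∈ S.part S.ε → s ∈ AddSubgroup.zmultiples S.x := by
  classical
  have hp := S.hp
  -- ### the upper bound
  have hle := S.card_sel_le_of_casselsTate_of_torsion P halt hPcross hPx hnd hCTV hCeb hcsupp hkill hE
  -- ### skew-symmetry; the quotient and its pairing
  have hskew : ∀ z t, P z t = -P t z := fun z t ↦ by
    have h := halt (z + t)
    simp only [map_add, AddMonoidHom.add_apply, halt, zero_add, add_zero] at h
    exact eq_neg_of_add_eq_zero_right h
  have hPx' : ∀ z, P z ⟨S.x, S.x_mem⟩ = 0 := fun z ↦ by rw [hskew, hPx, neg_zero]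
  have hPcross' : ∀ z t : S.Sel, (z : V) ∈ S.part (-S.ε) → (t : V) ∈ S.part S.ε → P z t = 0 :=
    fun z t hz ht ↦ by rw [hskew, hPcross t z ht hz, neg_zero]
  set N := (AddSubgroup.zmultiples S.x).addSubgroupOf S.Sel with hN
  obtain ⟨B, hB⟩ := S.exists_quotient_pairing'' P hPx hPx'
  have haltB : ∀ q, B q q = 0 := fun q ↦ by
    induction q using QuotientAddGroup.induction_on with
    | H z => rw [hB, halt]
  have hndB : ∀ q, (∀ r, B q r = 0) → q = 0 := by
    intro q hq
    induction q using QuotientAddGroup.induction_on with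
    | H z =>
      rw [S.quotient_mk_eq_zero_iff'']
      exact hnd z fun t ↦ by rw [← hB]; exact hq _
  set Selp : AddSubgroup S.Sel := (S.part S.ε).addSubgroupOf S.Sel with hSelp
  set Selm : AddSubgroup S.Sel := (S.part (-S.ε)).addSubgroupOf S.Sel with hSelm
  set Qp : AddSubgroup (S.Sel ⧸ N) := Selp.map (QuotientAddGroup.mk' N) with hQp
  set Qm : AddSubgroup (S.Sel ⧸ N) := Selm.map (QuotientAddGroup.mk' N) with hQm
  have hmemQp : ∀ {q}, q ∈ Qp ↔ ∃ z : S.Sel, (z : V) ∈ S.part S.ε ∧ QuotientAddGroup.mk z = q := by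
    intro q
    simp only [hQp, hSelp, AddSubgroup.mem_map, AddSubgroup.mem_addSubgroupOf,
      QuotientAddGroup.mk'_apply]
  have hmemQm : ∀ {q}, q ∈ Qm ↔
      ∃ z : S.Sel, (z : V) ∈ S.part (-S.ε) ∧ QuotientAddGroup.mk z = q := by
    intro q
    simp only [hQm, hSelm, AddSubgroup.mem_map, AddSubgroup.mem_addSubgroupOf,
      QuotientAddGroup.mk'_apply]
  have hsup : ∀ q : S.Sel ⧸ N, ∃ a ∈ Qp, ∃ b ∈ Qm, a + b = q := by
    intro q
    induction q using QuotientAddGroup.induction_on with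
    | H z =>
      obtain ⟨s₁, s₂, ⟨h₁, h₁'⟩, ⟨h₂, h₂'⟩, hsum⟩ := S.sel_split z z.2
      rcases S.hε with hε | hε
      · refine ⟨QuotientAddGroup.mk ⟨s₁, h₁⟩, hmemQp.mpr ⟨⟨s₁, h₁⟩, by rw [hε]; exact h₁', rfl⟩,
          QuotientAddGroup.mk ⟨s₂, h₂⟩, hmemQm.mpr ⟨⟨s₂, h₂⟩, by rw [hε]; exact h₂', rfl⟩, ?_⟩
        rw [← QuotientAddGroup.mk_add]
        exact congrArg _ (Subtype.ext hsum.symm)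
      · refine ⟨QuotientAddGroup.mk ⟨s₂, h₂⟩, hmemQp.mpr ⟨⟨s₂, h₂⟩, by rw [hε]; exact h₂', rfl⟩,
          QuotientAddGroup.mk ⟨s₁, h₁⟩,
          hmemQm.mpr ⟨⟨s₁, h₁⟩, by rw [hε, neg_neg]; exact h₁', rfl⟩, ?_⟩
        rw [← QuotientAddGroup.mk_add]
        exact congrArg _ (Subtype.ext (by rw [hsum, add_comm]; rfl))
  have hcodisj : Codisjoint Qp Qm := by
    rw [codisjoint_iff, eq_top_iff]
    intro q _
    obtain ⟨a, ha, b, hb, rfl⟩ := hsup q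
    exact AddSubgroup.add_mem_sup ha hb
  have hdisj : Disjoint Qp Qm := by
    rw [AddSubgroup.disjoint_def]
    intro q hq₁ hq₂
    obtain ⟨z, hz, rfl⟩ := hmemQp.mp hq₁
    obtain ⟨t, ht, hzt⟩ := hmemQm.mp hq₂
    have hdiff : ((t : V) - z) ∈ AddSubgroup.zmultiples S.x := by
      have h0 : (QuotientAddGroup.mk (t - z) : S.Sel ⧸ N) = 0 := by
        rw [QuotientAddGroup.mk_sub, hzt, sub_self]
      rw [S.quotient_mk_eq_zero_iff''] at h0
      simpa using h0
    have htε : (t : V) ∈ S.part S.ε := by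
      obtain ⟨k, hk⟩ := AddSubgroup.mem_zmultiples_iff.mp hdiff
      have : (t : V) = k • S.x + z := by rw [hk]; abel
      rw [this]
      exact (S.part S.ε).add_mem ((S.part S.ε).zsmul_mem S.x_part _) hz
    have ht0 : t = 0 := Subtype.ext (S.eq_zero_of_mem_part_both' htε ht)
    rw [← hzt, ht0, QuotientAddGroup.mk_zero]
  have hcompl : IsCompl Qp Qm := ⟨hdisj, hcodisj⟩
  have hBcross' : ∀ a ∈ Qm, ∀ b ∈ Qp, B a b = 0 := by
    intro a ha b hb
    obtain ⟨z, hz, rfl⟩ := hmemQm.mp ha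
    obtain ⟨t, ht, rfl⟩ := hmemQp.mp hb
    rw [hB]
    exact hPcross' z t hz ht
  have hndm : ∀ q ∈ Qm, (∀ r ∈ Qm, B q r = 0) → q = 0 := by
    intro q hq h
    refine hndB q fun r ↦ ?_
    obtain ⟨a, ha, b, hb, rfl⟩ := hsup r
    rw [map_add, hBcross' q hq a ha, h b hb, zero_add]
  -- ### the symplectic structure of `Q⁻`: `Q⁻ ≃ L × L`
  set B₀ : Qm →+ Qm →+ AddCircle (1 : ℚ) := (B.comp Qm.subtype).compl₂ Qm.subtype with hB₀
  have hB₀ap : ∀ a b : Qm, B₀ a b = B a b := fun a b ↦ rfl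
  have halt₀ : ∀ a : Qm, B₀ a a = 0 := fun a ↦ by rw [hB₀ap, haltB]
  have hnd₀ : ∀ a : Qm, (∀ b, B₀ a b = 0) → a = 0 := fun a ha ↦
    Subtype.ext (hndm a a.2 fun r hr ↦ by rw [← hB₀ap a ⟨r, hr⟩]; exact ha _)
  obtain ⟨L, -, ⟨e⟩⟩ := exists_addEquiv_prod_self B₀ halt₀ hnd₀
  -- ### the element of order `p^{M₀}` in `Q⁻`
  have hcard_ge : S.p ^ (2 * S.M₀) ≤ Nat.card Qm := by
    rcases Nat.eq_zero_or_pos S.M₀ with hM0 | hM0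
    · rw [hM0, mul_zero, pow_zero]
      exact Nat.card_pos
    obtain ⟨t, htS, hte, ht1, ht0⟩ := S.exists_mem_sel_part_neg_of_pow_zsmul_c_ne_zero' hM₀ hM0 hℓ₀
      (by rw [Nat.sub_zero]; exact hc₀)
    rw [Nat.sub_zero] at ht1
    -- `expo t = M₀`
    have hexpo : S.expo t = S.M₀ := by
      refine le_antisymm (S.expo_le_of_pow_zsmul_eq_zero'' ht0) ?_
      by_contra hlt
      push Not at hlt
      exact ht1 (pow_zsmul_eq_zero_of_le (by omega) (S.pow_expo_zsmul'' t))
    -- its image `q ∈ Q⁻` has order `p^{M₀}` (`t` is pure)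
    set q : S.Sel ⧸ N := QuotientAddGroup.mk ⟨t, htS⟩ with hq
    have hqm : q ∈ Qm := hmemQm.mpr ⟨⟨t, htS⟩, hte, rfl⟩
    have hordq : addOrderOf q = S.p ^ S.M₀ := by
      rw [← hexpo, hq, ← S.addOrderOf_eq_pow_expo'' t, addOrderOf_eq_addOrderOf_iff]
      intro n
      rw [← QuotientAddGroup.mk_nsmul, S.quotient_mk_eq_zero_iff'', AddSubgroupClass.coe_nsmul,
        ← natCast_zsmul]
      exact ⟨fun h ↦ S.pure_of_mem_part_neg' hte _ h, fun h ↦ by rw [h]; exact zero_mem _⟩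
    -- transport to `L × L`: `p^{M₀} ∣ #L`
    have hordq' : addOrderOf (e ⟨q, hqm⟩) = S.p ^ S.M₀ := by
      rw [AddEquiv.addOrderOf_eq, ← hordq]
      exact (addOrderOf_injective Qm.subtype Subtype.val_injective ⟨q, hqm⟩).symm
    have hdvd : S.p ^ S.M₀ ∣ Nat.card L := by
      rw [← hordq', Prod.addOrderOf]
      exact Nat.lcm_dvd (addOrderOf_dvd_natCard _) (addOrderOf_dvd_natCard _)
    have hLpos : 0 < Nat.card L := Nat.card_pos
    have hL : S.p ^ S.M₀ ≤ Nat.card L := Nat.le_of_dvd hLpos hdvd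
    rw [Nat.card_congr e.toEquiv, Nat.card_prod, two_mul, pow_add]
    exact Nat.mul_le_mul hL hL
  -- ### counting
  have hQ : Nat.card (S.Sel ⧸ N) = Nat.card Qp * Nat.card Qm := card_eq_mul_of_isCompl hcompl
  have hSel : Nat.card S.Sel = S.p ^ S.M * (Nat.card Qp * Nat.card Qm) := by
    rw [← hQ]; exact S.card_sel_eq''
  have hppos : 0 < S.p ^ S.M := pow_pos hp.pos _
  have hQp_pos : 0 < Nat.card Qp := Nat.card_pos
  have hQle : Nat.card Qp * Nat.card Qm ≤ S.p ^ (2 * S.M₀) := by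
    rw [hSel] at hle
    exact Nat.le_of_mul_le_mul_left hle hppos
  have hipos : 0 < S.p ^ (2 * S.M₀) := pow_pos hp.pos _
  have hQp1 : Nat.card Qp = 1 := by
    by_contra h
    have h2 : 2 ≤ Nat.card Qp := by omega
    have : 2 * S.p ^ (2 * S.M₀) ≤ Nat.card Qp * Nat.card Qm := Nat.mul_le_mul h2 hcard_ge
    omega
  have hQm_eq : Nat.card Qm = S.p ^ (2 * S.M₀) := by
    refine le_antisymm ?_ hcard_ge
    rw [hQp1, one_mul] at hQle
    exact hQle
  refine ⟨by rw [hSel, hQp1, one_mul, hQm_eq], fun s hs hse ↦ ?_⟩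
  -- `Q⁺ = 0`: every class of `Sel ∩ V^{ε}` is `≡ 0 mod ℤx`
  have hQp_bot : Qp = ⊥ := Qp.eq_bot_of_card_eq hQp1
  have hmem : (QuotientAddGroup.mk ⟨s, hs⟩ : S.Sel ⧸ N) ∈ Qp := hmemQp.mpr ⟨⟨s, hs⟩, hse, rfl⟩
  rw [hQp_bot, AddSubgroup.mem_bot, S.quotient_mk_eq_zero_iff''] at hmem
  exact hmem

/-- **Exactness with the annihilator discharged, value formula on `p^{2M₀}`-torsion classes only.** As
`card_sel_eq_of_primitive_of_le`, with the restricted `hCTV`. [cite: McCallumLMS1991, Thm. 5.4, Cor. 5.6 (case M₁ = 0)]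
[cite: Kolyvagin1989Izv, §3] -/
theorem card_sel_eq_of_primitive_of_le_of_torsion [Finite S.Sel] (P : S.Sel →+ S.Sel →+ AddCircle (1 : ℚ))
    (halt : ∀ z, P z z = 0)
    (hPcross : ∀ z t : S.Sel, (z : V) ∈ S.part S.ε → (t : V) ∈ S.part (-S.ε) → P z t = 0)
    (hPx : ∀ t, P ⟨S.x, S.x_mem⟩ t = 0)
    (hnd : ∀ z : S.Sel, (∀ t, P z t = 0) → (z : V) ∈ AddSubgroup.zmultiples S.x)
    (hCTV : ∀ ℓ m : ℕ, S.Kol ℓ → KolSupp S.Kol (ℓ * m) → ¬ ℓ ∣ m →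
      ∀ (j N a b : ℕ) (t : V) (ht : t ∈ S.Sel) (hz : ((S.p : ℤ) ^ j) • S.c (ℓ * m) ∈ S.Sel),
      ((S.p : ℤ) ^ N) • t = 0 → ((S.p : ℤ) ^ (2 * S.M₀)) • t = 0 →
      t ∈ S.part (S.ε * (-1) ^ (ℓ * m).primeFactors.card) →
      (∀ q ∈ m.primeFactors, t ∈ S.A q) → S.M - S.M₀ ≤ j → N + S.M₀ ≤ S.M → N ≤ j → a + b + 1 = N →
      ((S.p : ℤ) ^ (a + (j - N))) • S.c m ∉ S.A ℓ → ((S.p : ℤ) ^ b) • t ∉ S.A ℓ →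
      P ⟨_, hz⟩ ⟨t, ht⟩ ≠ 0)
    (hCeb : ∀ (T : Finset V) (g₁ g₂ : V) (ν : ℤ), (ν = 1 ∨ ν = -1) → g₁ ∈ S.part ν →
      g₂ ∈ S.part (-ν) → (∀ t ∈ T, ∃ e : ℤ, (e = 1 ∨ e = -1) ∧ t ∈ S.part e) →
      (∀ g ∈ AddSubgroup.closure (insert g₁ (insert g₂ (T : Set V))), S.rK g = 0 → g = 0) →
      ∀ b : ℕ, ∃ ℓ, b < ℓ ∧ S.Kol ℓ ∧ (∀ t ∈ T, t ∈ S.A ℓ) ∧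
        (∀ j : ℕ, ((S.p : ℤ) ^ j) • g₁ ∈ S.A ℓ ↔
          ((S.p : ℤ) ^ j) • g₁ ∈ AddSubgroup.closure (T : Set V)) ∧
        (∀ j : ℕ, ((S.p : ℤ) ^ j) • g₂ ∈ S.A ℓ ↔
          ((S.p : ℤ) ^ j) • g₂ ∈ AddSubgroup.closure (T : Set V)))
    (hcsupp : ∀ n, KolSupp S.Kol n → ∀ v, (∀ q, S.Kol q → v ≠ S.pl q) → S.c n ∈ S.Loc v)
    (h3 : 3 * S.M₀ ≤ S.M) {ℓ₀ : ℕ} (hℓ₀ : S.Kol ℓ₀) (hc₀ : ((S.p : ℤ) ^ (S.M - 1)) • S.c ℓ₀ ≠ 0) :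
    Nat.card S.Sel = S.p ^ S.M * S.p ^ (2 * S.M₀) ∧
      ∀ s ∈ S.Sel, s ∈ S.part S.ε → s ∈ AddSubgroup.zmultiples S.x := by
  -- the annihilator `p^{2M₀} Sel ⊆ ℤx` from Claims A and B
  have hkill : ∀ t ∈ S.Sel, ((S.p : ℤ) ^ (2 * S.M₀)) • t ∈ AddSubgroup.zmultiples S.x := by
    intro t ht
    obtain ⟨s₁, s₂, ⟨h₁, h₁'⟩, ⟨h₂, h₂'⟩, hsum⟩ := S.sel_split t ht
    -- the two parts, in the order `(ε, -ε)`
    have key : ∀ sp sm : V, sp ∈ S.Sel → sp ∈ S.part S.ε → sm ∈ S.Sel → sm ∈ S.part (-S.ε) →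
        ((S.p : ℤ) ^ (2 * S.M₀)) • (sp + sm) ∈ AddSubgroup.zmultiples S.x := by
      intro sp sm hsp hspe hsm hsme
      obtain ⟨a, ha⟩ := S.claimB hsp hspe
      have hsm0 : ((S.p : ℤ) ^ (2 * S.M₀)) • sm = 0 :=
        pow_zsmul_eq_zero_of_le (by omega) (S.claimA hsm hsme)
      rw [zsmul_add, ha, hsm0, add_zero]
      exact AddSubgroup.zsmul_mem _ (AddSubgroup.mem_zmultiples _) _
    rcases S.hε with hε | hε
    · rw [hsum]
      exact key s₁ s₂ h₁ (by rw [hε]; exact h₁') h₂ (by rw [hε]; exact h₂')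
    · rw [hsum, add_comm]
      exact key s₂ s₁ h₂ (by rw [hε]; exact h₂') h₁ (by rw [hε, neg_neg]; exact h₁')
  exact S.card_sel_eq_of_primitive_of_torsion P halt hPcross hPx hnd hCTV hCeb hcsupp hkill (by omega) (by omega)
    hℓ₀ hc₀

end Exact

end VisibleSplitHypothesesM

end KolyvaginDescent

end Literature.NumberTheory.EllipticCurves
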